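import Literature.NumberTheory.LFunctions.NicolasPsiTheta
import Mathlib.Analysis.Complex.ExponentialBounds
import Mathlib.Data.List.TakeWhile
import HarnessLib

/-!
# Nicolas 2012, Lemma 2.4, Case 1: a kernel-checked certificate

`ψ(x) − θ(x) ≤ √x + 1.332769 · x^{1/3}` for `1 ≤ x < 2^32`.

Topic: `Literature/NumberTheory/LFunctions`. This file DISCHARGES the named fact
`Nicolas2012_lemma24_case1` of `NicolasPsiTheta.lean`: J.-L. Nicolas, Acta Arith. 155 (2012),
proof of Lemma 2.4, Case 1 ("`1 ≤ x < 2^32` … by computing `G(q_0), …, G(q_6947)` we get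
`G(x) ≤ G(q_103) = 1.332768…`"), i.e. for real `1 ≤ x < 2^32`,
`ψ(x) − θ(x) ≤ √x + 1.332769 · x^{1/3}`.

## The certificate

`ψ(x) − θ(x) = ∑_{2 ≤ k ≤ 31} θ(x^{1/k}) = ∑_{p prime, 2 ≤ k ≤ 31, p^k ≤ x} log p` (Mathlib's
`Chebyshev.psi_eq_theta_add_sum_theta'`, `x < 2^32`), a step function of `x` jumping exactly at
the 6947 prime powers `p^k < 2^32`, `k ≥ 2`, while the right-hand side increases; so it suffices
to check the inequality at each jump with the left side evaluated there. The checker (`case1Check`,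
evaluated by the KERNEL through `decide +kernel`, ≈ 25 s; no `native_decide`, no extra axioms)
does exactly this:

* *events*: all `(p^k, p)` with `p` "good" (no prime factor `< 257` below `p`; a superset of the
  primes below `2^16`, found by trial division inside the kernel), `k ≥ 2`, `p^k < 2^32`, produced
  in increasing order of `p^k` (`trace`); the order is re-verified while checking (`checkTrace`),
  and completeness of the enumeration is PROVED (`mem_trace_sq`, `mem_trace_higher`);
* along the trace the exact product `N` of the bases is maintained (`log N ≥ ψ − θ` there) and
  compared with the right-hand side at the event value `v`: the *crude* test `N < 2^B`,
  `B = ⌊(r₂ + 1.332769 r₃)/0.6931472⌋` with `r₂² ≤ v`, `r₃³ ≤ v` (`crude`, `crude_sound`), and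
  where it fails (only at `v = 113², 283²`, the latter being Nicolas's extremal `q_103`, slack
  `3.6·10⁻⁵`) the *precise* test `N · D^512 ≤ T^512` where `T/D` is the degree-15 Taylor
  polynomial of `exp` at `R/512`, `R = s/2^32 + 1.332769 · c/2^32 ≤ √v + 1.332769 v^{1/3}`
  (`s² ≤ 2^64 v`, `c³ ≤ 2^96 v`) (`precise`, `precise_sound`, via `Real.sum_le_exp_of_nonneg`).

Soundness (`sum_log_le_of_case1Check`) is proved once for the abstract checker; the only computation
trusted to the kernel is `case1Check = true` (`case1Check_eq_true`). Kernel-evaluation discipline: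
loops are `Nat.rec`/`List.rec` with `bif` and the GMP-accelerated `Nat.blt/ble/beq/mul/mod/div/pow`,
and every natural-number state component is re-literalised at each step (`force`), which keeps the
reduction linear.

## References

* J.-L. Nicolas, *Small values of the Euler function and the Riemann hypothesis*, Acta Arith. 155
  (2012), 311–321 (arXiv:1202.0729), Lemma 2.4, proof, Case 1. [Nicolas2012]
-/

noncomputable section

open Real Finset
open scoped Chebyshev

namespace Literature.NumberTheory.LFunctions

namespace Nicolas2012Case1

/-! ### The checker (kernel-evaluable definitions) -/

/-- The primes below `257` (trial-division moduli; `257² > 2^16`). [folklore] -/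
def smallPrimes : List ℕ :=
  [2, 3, 5, 7, 11, 13, 17, 19, 23, 29, 31, 37, 41, 43, 47, 53, 59, 61, 67, 71, 73, 79, 83, 89, 97,
   101, 103, 107, 109, 113, 127, 131, 137, 139, 149, 151, 157, 163, 167, 173, 179, 181, 191, 193,
   197, 199, 211, 223, 227, 229, 233, 239, 241, 251]

/-- Trial division of `j` by the list `l`: `false` iff some `p ∈ l` with `p² ≤ j` (before the first
`p` with `j < p²`) divides `j`. [folklore] -/
def noFactor (j : ℕ) (l : List ℕ) : Bool :=
  List.rec (motive := fun _ => Bool) true (fun p _ ih =>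
    bif Nat.blt j (p * p) then true else bif Nat.beq (Nat.mod j p) 0 then false else ih) l

/-- `good j`: `2 ≤ j` and trial division by `smallPrimes` finds no proper factor — a superset of the
primes (`prime_good`), equal to them below `257²`. [folklore] -/
def good (j : ℕ) : Bool := Nat.ble 2 j && noFactor j smallPrimes

/-- Re-literalise a natural number before continuing (kernel-evaluation device; `force n k = k n`).
[folklore] -/
def force {α : Sort*} (n : ℕ) (k : ℕ → α) : α :=
  Nat.casesOn (motive := fun _ => α) n (k 0) fun m => k (Nat.succ m)

/-- Higher-power events `(r^k, r)` for the `cnt` consecutive bases `r, r+1, …` that are `good` and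
have `r^k < 2^32`, in increasing order. [folklore] -/
def genK (k : ℕ) (cnt : ℕ) : ℕ → List (ℕ × ℕ) :=
  Nat.rec (motive := fun _ => ℕ → List (ℕ × ℕ)) (fun _ => []) (fun _ ih r =>
    force (Nat.succ r) fun r' =>
      bif good r && Nat.blt (Nat.pow r k) 4294967296 then (Nat.pow r k, r) :: ih r' else ih r') cnt

/-- Merge two event lists by value; with exhausted fuel the remainders are appended (so membership
is always preserved, `mem_mergeV`). [folklore] -/
def mergeV (fuel : ℕ) : List (ℕ × ℕ) → List (ℕ × ℕ) → List (ℕ × ℕ) :=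
  Nat.rec (motive := fun _ => List (ℕ × ℕ) → List (ℕ × ℕ) → List (ℕ × ℕ)) (fun l₁ l₂ => l₁ ++ l₂)
    (fun _ ih l₁ l₂ =>
      List.casesOn (motive := fun _ => List (ℕ × ℕ)) l₁ l₂ fun a as =>
        List.casesOn (motive := fun _ => List (ℕ × ℕ)) l₂ (a :: as) fun b bs =>
          bif Nat.ble a.1 b.1 then a :: ih as (b :: bs) else b :: ih (a :: as) bs) fuel

/-- `(k, R_k)` for `3 ≤ k ≤ 31`: `R_k` is the largest base with `R_k ^ k < 2^32`. [folklore] -/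
def rangeTable : List (ℕ × ℕ) :=
  [(3, 1625), (4, 255), (5, 84), (6, 40), (7, 23), (8, 15), (9, 11), (10, 9), (11, 7), (12, 6),
   (13, 5), (14, 4), (15, 4), (16, 3), (17, 3), (18, 3), (19, 3), (20, 3), (21, 2), (22, 2),
   (23, 2), (24, 2), (25, 2), (26, 2), (27, 2), (28, 2), (29, 2), (30, 2), (31, 2)]

/-- All higher-power events (`k ≥ 3`), merged by value. [folklore] -/
def higher : List (ℕ × ℕ) :=
  rangeTable.foldr (fun kr acc => mergeV 8192 (genK kr.1 (kr.2 - 1) 2) acc) []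

/-- Pop the events of `rest` with value `< m2` (tagging them with the square-root candidate `r2`),
then continue with `cont` on the remainder. [folklore] -/
def popLoop (fuel : ℕ) (m2 r2 : ℕ) :
    List (ℕ × ℕ) → (List (ℕ × ℕ) → List (ℕ × ℕ × ℕ)) → List (ℕ × ℕ × ℕ) :=
  Nat.rec (motive := fun _ => List (ℕ × ℕ) → (List (ℕ × ℕ) → List (ℕ × ℕ × ℕ)) → List (ℕ × ℕ × ℕ))
    (fun rest cont => cont rest)
    (fun _ ih rest cont =>
      List.casesOn (motive := fun _ => List (ℕ × ℕ × ℕ)) rest (cont []) fun e es =>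
        bif Nat.blt e.1 m2 then (e.1, e.2, r2) :: ih es cont else cont (e :: es)) fuel

/-- The event generator: for `m = m₀, m₀ + 1, …` (`fuel` of them) first the higher events of value
`< m²` (tagged `r2 = m − 1`), then the square event `(m², m, m)` when `good m`; finally the leftover
higher events. Trace elements are `(value, base, r2)`. [folklore] -/
def evGen (fuel : ℕ) : ℕ → List (ℕ × ℕ) → List (ℕ × ℕ × ℕ) :=
  Nat.rec (motive := fun _ => ℕ → List (ℕ × ℕ) → List (ℕ × ℕ × ℕ))
    (fun m rest => rest.map fun e => (e.1, e.2, Nat.pred m))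
    (fun _ ih m rest =>
      force (Nat.succ m) fun m' =>
        popLoop 32 (Nat.mul m m) (Nat.pred m) rest fun rest' =>
          bif good m then (Nat.mul m m, m, m) :: ih m' rest' else ih m' rest') fuel

/-- The trace of all `6947` events `(p^k, p, r2)`, `p` good, `k ≥ 2`, `p^k < 2^32`, by value.
[cite: Nicolas2012, Lemma 2.4, proof, Case 1] -/
def trace : List (ℕ × ℕ × ℕ) := evGen 65534 2 higher

/-- Advance the cube-root tracker `r` while `(r+1)^3 ≤ v`. [folklore] -/
def bump (fuel : ℕ) (v : ℕ) : ℕ → ℕ :=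
  Nat.rec (motive := fun _ => ℕ → ℕ) (fun r => r)
    (fun _ ih r => bif Nat.ble (Nat.pow (r + 1) 3) v then ih (Nat.succ r) else r) fuel

/-- Crude test: `r2² ≤ v`, `r3³ ≤ v` and `N < 2^B` with `B = ⌊(r2·10⁷ + r3·13327690)/6931472⌋`, so
that `log N < B log 2 ≤ r2 + 1.332769 r3 ≤ √v + 1.332769 v^{1/3}` (`crude_sound`). [folklore] -/
def crude (N v r2 r3 : ℕ) : Bool :=
  Nat.ble (r2 * r2) v && Nat.ble (Nat.pow r3 3) v &&
    Nat.blt N (Nat.pow 2 ((r2 * 10000000 + r3 * 13327690) / 6931472))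

/-- Bisection towards the largest `s < hi` with `s ^ e ≤ X` (from `lo ^ e ≤ X`); only `s ^ e ≤ X` of
the result is ever used, and it is re-checked. [folklore] -/
def bisect (e X : ℕ) (fuel : ℕ) : ℕ → ℕ → ℕ :=
  Nat.rec (motive := fun _ => ℕ → ℕ → ℕ) (fun lo _ => lo)
    (fun _ ih lo hi =>
      force ((lo + hi) / 2) fun mid =>
        bif Nat.ble (Nat.pow mid e) X then (bif Nat.beq mid lo then lo else ih mid hi)
        else ih lo mid)
    fuel

/-- `∑_{i < 16} a^i d^{15−i} · (15!/i!)`, the degree-15 Taylor polynomial of `exp (a/d)` times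
`d^15 · 15!`. [folklore] -/
def taylorNum (a d : ℕ) : ℕ :=
  ∑ i ∈ Finset.range 16, a ^ i * d ^ (15 - i) * (Nat.factorial 15 / Nat.factorial i)

/-- The Taylor denominator `d^15 · 15!`, `d = 2^41 · 10^6 = 2199023255552000000`. [folklore] -/
def taylorDen : ℕ := Nat.pow 2199023255552000000 15 * Nat.factorial 15

/-- The numeric core of the precise test: `N · taylorDen^512 ≤ taylorNum a d ^ 512` with
`a = 10⁶ s + 1332769 c`, `d = 2^41 · 10⁶`, whence `N ≤ T₁₆(a/d)^512 ≤ exp (512 a/d) =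
exp ((s + 1.332769 c)/2^32)` (`preciseCore_sound`). [folklore] -/
def preciseCore (N s c : ℕ) : Bool :=
  Nat.ble (N * Nat.pow taylorDen 512)
    (Nat.pow (taylorNum (s * 1000000 + 1332769 * c) 2199023255552000000) 512)

/-- Precise test (only for `v < 2^17`): `preciseCore N s c` with `s² ≤ 2^64 v`, `c³ ≤ 2^96 v` found
by bisection, so that `(s + 1.332769 c)/2^32 ≤ √v + 1.332769 v^{1/3}` (`precise_sound`).
[folklore] -/
def precise (N v : ℕ) : Bool :=
  Nat.blt v 131072 &&
    force (bisect 2 (v * 18446744073709551616) 64 0 1152921504606846976) fun s =>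
      force (bisect 3 (v * 79228162514264337593543950336) 64 0 1152921504606846976) fun c =>
        Nat.ble (s * s) (v * 18446744073709551616) &&
          Nat.ble (Nat.pow c 3) (v * 79228162514264337593543950336) && preciseCore N s c

/-- One pass over a trace with state `(lastV, N, r3)`: values strictly increase, bases are `≥ 2`,
`N` is the running product of the bases, `r3` the cube-root tracker, and every event passes `crude`
or `precise`. [folklore] -/
def checkTrace (l : List (ℕ × ℕ × ℕ)) : ℕ → ℕ → ℕ → Bool :=
  List.rec (motive := fun _ => ℕ → ℕ → ℕ → Bool) (fun _ _ _ => true)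
    (fun e _ ih lastV N r3 =>
      bif Nat.blt lastV e.1 && Nat.ble 2 e.2.1 then
        force (N * e.2.1) fun N' =>
          force (bump 8 e.1 r3) fun r3' =>
            bif (crude N' e.1 e.2.2 r3' || precise N' e.1) then ih e.1 N' r3' else false
      else false) l

/-- The whole Case-1 certificate. [cite: Nicolas2012, Lemma 2.4, proof, Case 1] -/
def case1Check : Bool := checkTrace trace 0 1 1

/-- **The kernel computation** (≈ 25 s): the certificate checks.
[cite: Nicolas2012, Lemma 2.4, proof, Case 1] -/
theorem case1Check_eq_true : case1Check = true := by
  decide +kernel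

/-- The range table covers every base: `2^32 ≤ (R_k + 1)^k`. [folklore] -/
theorem rangeTable_sound : ∀ kr ∈ rangeTable, 4294967296 ≤ (kr.2 + 1) ^ kr.1 := by
  decide +kernel

/-- Every exponent `3 ≤ k ≤ 31` occurs in the range table. [folklore] -/
theorem rangeTable_complete : ∀ k ∈ Finset.Icc 3 31, ∃ kr ∈ rangeTable, kr.1 = k := by
  decide +kernel

/-- The trace starts with the event `2² = 4`. [folklore] -/
theorem trace_eq_cons : ∃ t, trace = (4, 2, 2) :: t := by
  have h : trace.head? = some (4, 2, 2) := by decide +kernel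
  cases ht : trace with
  | nil => rw [ht] at h; simp at h
  | cons e t =>
    rw [ht] at h
    simp only [List.head?_cons, Option.some.injEq] at h
    exact ⟨t, by rw [h]⟩

/-! ### Elementary unfolding lemmas -/

/-- `force` is the identity on values. [folklore] -/
theorem force_eq {α : Sort*} (n : ℕ) (k : ℕ → α) : force n k = k n := by
  cases n <;> rfl

/-- `bif c then t else false` is `c && t`. [folklore] -/
theorem bif_and_eq_true {c t : Bool} : (bif c then t else false) = true ↔ c = true ∧ t = true := by
  cases c <;> simp

/-! ### Arithmetic soundness of the two tests -/

/-- The right-hand side `√v + 1.332769 · v^{1/3}` at a natural number.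
[cite: Nicolas2012, Lemma 2.4 (2.12)] -/
def rhs (v : ℕ) : ℝ := Real.sqrt v + 1.332769 * (v : ℝ) ^ ((1 : ℝ) / 3)

/-- `rhs` is dominated by the real right-hand side at any `x ≥ v`. [folklore] -/
theorem rhs_le {v : ℕ} {x : ℝ} (hx : (v : ℝ) ≤ x) :
    rhs v ≤ Real.sqrt x + 1.332769 * x ^ ((1 : ℝ) / 3) := by
  unfold rhs
  gcongr

/-- `r² ≤ v` gives `r ≤ √v`. [folklore] -/
theorem natCast_le_sqrt {r v : ℕ} (h : r * r ≤ v) : (r : ℝ) ≤ Real.sqrt v := by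
  rw [Real.le_sqrt (by positivity) (by positivity)]
  exact_mod_cast (by nlinarith [h] : r ^ 2 ≤ v)

/-- `r³ ≤ v` gives `r ≤ v^{1/3}`. [folklore] -/
theorem natCast_le_rpow_third {r v : ℕ} (h : r ^ 3 ≤ v) : (r : ℝ) ≤ (v : ℝ) ^ ((1 : ℝ) / 3) := by
  have h' : ((r : ℝ) ^ (3 : ℝ)) ≤ v := by exact_mod_cast h
  rw [one_div]
  exact (Real.le_rpow_inv_iff_of_pos (by positivity) (by positivity) (by norm_num)).2 h'

/-- **Soundness of the crude test.** [folklore] -/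
theorem crude_sound {N v r2 r3 : ℕ} (hN : 0 < N) (h : crude N v r2 r3 = true) :
    Real.log N ≤ rhs v := by
  simp only [crude, Bool.and_eq_true, Nat.ble_eq, Nat.blt_eq] at h
  obtain ⟨⟨h2, h3⟩, hB⟩ := h
  set B := (r2 * 10000000 + r3 * 13327690) / 6931472 with hBdef
  have hBle : B * 6931472 ≤ r2 * 10000000 + r3 * 13327690 := Nat.div_mul_le_self _ _
  have hBle' : (B : ℝ) * 6931472 ≤ r2 * 10000000 + r3 * 13327690 := by exact_mod_cast hBle
  have hNr : (N : ℝ) < (2 : ℝ) ^ B := by exact_mod_cast hB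
  have hlog : Real.log N < B * Real.log 2 := by
    rw [← Real.log_pow]
    exact Real.log_lt_log (by exact_mod_cast hN) hNr
  have hl2 := Real.log_two_lt_d9
  have hl2' : 0 < Real.log 2 := Real.log_pos one_lt_two
  have hB0 : (0 : ℝ) ≤ B := by positivity
  have hsq := natCast_le_sqrt h2
  have hcb := natCast_le_rpow_third h3
  unfold rhs
  nlinarith

/-- `taylorNum a d / taylorDen'` is the Taylor polynomial: for `d ≠ 0`,
`taylorNum a d = d^15 · 15! · ∑_{i<16} (a/d)^i / i!`. [folklore] -/
theorem taylorNum_eq (a d : ℕ) (hd : (d : ℝ) ≠ 0) :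
    (taylorNum a d : ℝ) = (d : ℝ) ^ 15 * (Nat.factorial 15 : ℝ) *
      ∑ i ∈ Finset.range 16, ((a : ℝ) / d) ^ i / (Nat.factorial i : ℝ) := by
  unfold taylorNum
  push_cast
  rw [Finset.mul_sum]
  refine Finset.sum_congr rfl fun i hi ↦ ?_
  have hi' : i ≤ 15 := by simpa [Finset.mem_range, Nat.lt_succ_iff] using hi
  have hdiv : (Nat.factorial i) ∣ Nat.factorial 15 := Nat.factorial_dvd_factorial hi'
  have hfi : (Nat.factorial i : ℝ) ≠ 0 := by positivity
  rw [Nat.cast_div hdiv hfi]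
  have hpow : (d : ℝ) ^ 15 = (d : ℝ) ^ (15 - i) * (d : ℝ) ^ i := by
    rw [← pow_add, Nat.sub_add_cancel hi']
  rw [hpow, div_pow]
  field_simp

/-- **Soundness of the numeric core of the precise test.** (The certificate hypothesis is
introduced last and cleared early: it hides a huge computation that `positivity`/`isDefEq` must
never be tempted to unfold.) [folklore] -/
theorem preciseCore_sound {N s c : ℕ} (hN : 0 < N) (h : preciseCore N s c = true) :
    Real.log N ≤ ((s : ℝ) + 1.332769 * c) / 2 ^ 32 := by
  have hd0 : (2199023255552000000 : ℝ) ≠ 0 := by norm_num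
  have hdpos : (0 : ℝ) < 2199023255552000000 := by norm_num
  have hx0 : (0 : ℝ) ≤ ((s : ℝ) * 1000000 + 1332769 * c) / 2199023255552000000 :=
    div_nonneg (by positivity) hdpos.le
  have hTaylor := Real.sum_le_exp_of_nonneg hx0 16
  have hsum0 : (0 : ℝ) ≤ ∑ i ∈ Finset.range 16,
      (((s : ℝ) * 1000000 + 1332769 * c) / 2199023255552000000) ^ i / (Nat.factorial i : ℝ) :=
    Finset.sum_nonneg fun i _ ↦ div_nonneg (pow_nonneg hx0 _) (Nat.cast_nonneg _)
  have hDen : (taylorDen : ℝ) = 2199023255552000000 ^ 15 * (Nat.factorial 15 : ℝ) := by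
    rw [taylorDen, Nat.pow_eq]
    push_cast
    ring
  have hDenPos : (0 : ℝ) < taylorDen := by
    rw [hDen]
    exact mul_pos (pow_pos hdpos 15) (by exact_mod_cast Nat.factorial_pos 15)
  have hquot : (taylorNum (s * 1000000 + 1332769 * c) 2199023255552000000 : ℝ) =
      (∑ i ∈ Finset.range 16, (((s : ℝ) * 1000000 + 1332769 * c) / 2199023255552000000) ^ i /
        (Nat.factorial i : ℝ)) * taylorDen := by
    rw [taylorNum_eq _ _ (by exact_mod_cast hd0), hDen]
    push_cast
    ring
  -- the certificate, used once
  have hT' : (N : ℝ) * (taylorDen : ℝ) ^ 512 ≤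
      (taylorNum (s * 1000000 + 1332769 * c) 2199023255552000000 : ℝ) ^ 512 := by
    have hT := (Nat.cast_le (α := ℝ)).2 (Nat.le_of_ble_eq_true h)
    simp only [Nat.pow_eq, Nat.cast_mul, Nat.cast_pow] at hT
    exact hT
  clear h
  rw [hquot, mul_pow] at hT'
  have hN1 : (N : ℝ) ≤ (∑ i ∈ Finset.range 16, (((s : ℝ) * 1000000 + 1332769 * c) /
      2199023255552000000) ^ i / (Nat.factorial i : ℝ)) ^ 512 :=
    le_of_mul_le_mul_right hT' (pow_pos hDenPos 512)
  clear hT'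
  have hN2 : (N : ℝ) ≤ Real.exp (((s : ℝ) * 1000000 + 1332769 * c) / 2199023255552000000) ^ 512 :=
    hN1.trans (pow_le_pow_left₀ hsum0 hTaylor 512)
  rw [← Real.exp_nat_mul] at hN2
  have hN3 := (Real.log_le_iff_le_exp (by exact_mod_cast hN)).2 hN2
  refine hN3.trans (le_of_eq ?_)
  push_cast
  ring

/-- **Soundness of the precise test.** [folklore] -/
theorem precise_sound {N v : ℕ} (hN : 0 < N) (h : precise N v = true) : Real.log N ≤ rhs v := by
  unfold precise at h
  rw [Bool.and_eq_true, force_eq, force_eq] at h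
  obtain ⟨-, h⟩ := h
  generalize bisect 2 (v * 18446744073709551616) 64 0 1152921504606846976 = s at h
  generalize bisect 3 (v * 79228162514264337593543950336) 64 0 1152921504606846976 = c at h
  rw [Bool.and_eq_true, Bool.and_eq_true] at h
  obtain ⟨⟨hs, hc⟩, hcore⟩ := h
  have hs' : s * s ≤ v * 18446744073709551616 := Nat.le_of_ble_eq_true hs
  have hc' : c ^ 3 ≤ v * 79228162514264337593543950336 := Nat.le_of_ble_eq_true hc
  refine (preciseCore_sound hN hcore).trans ?_
  -- `s ≤ 2^32 √v` and `c ≤ 2^32 v^{1/3}`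
  have hsR : (s : ℝ) ≤ 2 ^ 32 * Real.sqrt v := by
    have h1 : (s : ℝ) * s ≤ (v : ℝ) * (2 ^ 32) ^ 2 := by
      have : ((s * s : ℕ) : ℝ) ≤ ((v * 18446744073709551616 : ℕ) : ℝ) := by exact_mod_cast hs'
      push_cast at this
      nlinarith [this]
    have h2 : (s : ℝ) ≤ Real.sqrt ((v : ℝ) * (2 ^ 32) ^ 2) := by
      rw [Real.le_sqrt (by positivity) (by positivity)]
      nlinarith [h1]
    rw [Real.sqrt_mul' _ (by positivity), Real.sqrt_sq (by positivity)] at h2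
    linarith
  have hcR : (c : ℝ) ≤ 2 ^ 32 * (v : ℝ) ^ ((1 : ℝ) / 3) := by
    have h1 : ((c : ℝ) ^ (3 : ℝ)) ≤ (v : ℝ) * (2 ^ 32) ^ (3 : ℝ) := by
      have : ((c ^ 3 : ℕ) : ℝ) ≤ ((v * 79228162514264337593543950336 : ℕ) : ℝ) := by
        exact_mod_cast hc'
      push_cast at this
      have e1 : ((c : ℝ) ^ (3 : ℝ)) = (c : ℝ) ^ (3 : ℕ) := by
        exact_mod_cast Real.rpow_natCast (c : ℝ) 3
      have e2 : ((2 : ℝ) ^ 32) ^ (3 : ℝ) = ((2 : ℝ) ^ 32) ^ (3 : ℕ) := by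
        exact_mod_cast Real.rpow_natCast ((2 : ℝ) ^ 32) 3
      rw [e1, e2]
      nlinarith [this]
    have h2 : (c : ℝ) ≤ ((v : ℝ) * (2 ^ 32) ^ (3 : ℝ)) ^ ((1 : ℝ) / 3) := by
      rw [one_div]
      exact (Real.le_rpow_inv_iff_of_pos (by positivity) (by positivity) (by norm_num)).2 h1
    rw [Real.mul_rpow (by positivity) (by positivity), ← Real.rpow_mul (by positivity),
      show (3 : ℝ) * (1 / 3) = 1 by norm_num, Real.rpow_one] at h2
    linarith
  rw [div_le_iff₀ (by positivity)]
  unfold rhs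
  nlinarith [hsR, hcR, Real.sqrt_nonneg (v : ℝ), Real.rpow_nonneg (Nat.cast_nonneg v) ((1 : ℝ) / 3)]

/-! ### Generic soundness of the trace pass -/

/-- The product of the bases of a trace segment. [folklore] -/
def bprod (l : List (ℕ × ℕ × ℕ)) : ℕ := (l.map fun e => e.2.1).prod

/-- Base product of the empty segment. [folklore] -/
@[simp] theorem bprod_nil : bprod [] = 1 := rfl

/-- Base product of a cons. [folklore] -/
@[simp] theorem bprod_cons (e : ℕ × ℕ × ℕ) (l : List (ℕ × ℕ × ℕ)) :
    bprod (e :: l) = e.2.1 * bprod l := rfl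

/-- Base product of a concatenation. [folklore] -/
@[simp] theorem bprod_append (l₁ l₂ : List (ℕ × ℕ × ℕ)) :
    bprod (l₁ ++ l₂) = bprod l₁ * bprod l₂ := by
  simp [bprod]

/-- **Soundness of `checkTrace`**: if the pass succeeds from state `(lastV, N, r3)` with `0 < N`,
then all values exceed `lastV` and all bases are `≥ 2`, the values are strictly increasing, and for
every prefix ending in an event `e`, `log (N · ∏ bases) ≤ rhs e.1`. [folklore] -/
theorem checkTrace_sound {l : List (ℕ × ℕ × ℕ)} {lastV N r3 : ℕ} (hN : 0 < N)
    (h : checkTrace l lastV N r3 = true) :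
    (∀ e ∈ l, lastV < e.1 ∧ 2 ≤ e.2.1) ∧ l.Pairwise (fun a b => a.1 < b.1) ∧
      ∀ l₁ e l₂, l = l₁ ++ e :: l₂ → Real.log ((N * bprod (l₁ ++ [e]) : ℕ) : ℝ) ≤ rhs e.1 := by
  induction l generalizing lastV N r3 with
  | nil => simp
  | cons x t ih =>
    have hx : checkTrace (x :: t) lastV N r3 =
        (bif Nat.blt lastV x.1 && Nat.ble 2 x.2.1 then
          force (N * x.2.1) fun N' => force (bump 8 x.1 r3) fun r3' =>
            bif (crude N' x.1 x.2.2 r3' || precise N' x.1) then checkTrace t x.1 N' r3' else false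
        else false) := rfl
    rw [hx, bif_and_eq_true] at h
    obtain ⟨h1, h2⟩ := h
    simp only [Bool.and_eq_true, Nat.blt_eq, Nat.ble_eq] at h1
    rw [force_eq, force_eq, bif_and_eq_true] at h2
    obtain ⟨hcheck, hrest⟩ := h2
    have hN' : 0 < N * x.2.1 := Nat.mul_pos hN (by omega)
    obtain ⟨ihA, ihP, ihB⟩ := ih hN' hrest
    refine ⟨?_, ?_, ?_⟩
    · intro e he
      rcases List.mem_cons.1 he with rfl | he
      · exact h1
      · exact ⟨h1.1.trans (ihA e he).1, (ihA e he).2⟩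
    · exact List.pairwise_cons.2 ⟨fun e he => (ihA e he).1, ihP⟩
    · intro l₁ e l₂ hl
      cases l₁ with
      | nil =>
        simp only [List.nil_append, List.cons.injEq] at hl
        obtain ⟨rfl, rfl⟩ := hl
        simp only [List.nil_append, bprod_cons, bprod_nil, mul_one]
        simp only [Bool.or_eq_true] at hcheck
        rcases hcheck with hc | hp
        · exact crude_sound hN' hc
        · exact precise_sound hN' hp
      | cons y l₁' =>
        simp only [List.cons_append, List.cons.injEq] at hl
        obtain ⟨rfl, rfl⟩ := hl
        have := ihB l₁' e l₂ rfl
        simpa [bprod, mul_assoc] using this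

/-! ### Completeness of the event enumeration -/

/-- Every trial-division modulus is at least `2`. [folklore] -/
theorem two_le_of_mem_smallPrimes : ∀ q ∈ smallPrimes, 2 ≤ q := by decide

/-- Trial division never rejects a prime. [folklore] -/
theorem noFactor_of_prime {p : ℕ} (hp : p.Prime) :
    ∀ (l : List ℕ), (∀ q ∈ l, 2 ≤ q) → noFactor p l = true
  | [], _ => rfl
  | q :: t, hl => by
    have hq : 2 ≤ q := hl q (by simp)
    show (bif Nat.blt p (q * q) then true
      else bif Nat.beq (Nat.mod p q) 0 then false else noFactor p t) = true
    cases hlt : Nat.blt p (q * q)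
    · have hle : q * q ≤ p := by
        by_contra hcon
        have h' : Nat.blt p (q * q) = true := by simp only [Nat.blt_eq]; omega
        rw [hlt] at h'
        exact Bool.false_ne_true h'
      cases hb : Nat.beq (Nat.mod p q) 0
      · simpa using noFactor_of_prime hp t fun r hr ↦ hl r (by simp [hr])
      · exfalso
        have h0 : p % q = 0 := Nat.eq_of_beq_eq_true hb
        rcases (Nat.dvd_prime hp).1 (Nat.dvd_of_mod_eq_zero h0) with h | h
        · omega
        · subst h; nlinarith
    · rfl

/-- Primes are `good`. [folklore] -/
theorem prime_good {p : ℕ} (hp : p.Prime) : good p = true := by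
  simp [good, Nat.ble_eq, hp.two_le, noFactor_of_prime hp smallPrimes two_le_of_mem_smallPrimes]

/-- Unfolding `genK` one step. [folklore] -/
theorem genK_succ (k c r : ℕ) : genK k (c + 1) r =
    (bif good r && Nat.blt (Nat.pow r k) 4294967296 then (Nat.pow r k, r) :: genK k c (r + 1)
      else genK k c (r + 1)) := rfl

/-- Membership in `genK`. [folklore] -/
theorem mem_genK {k r : ℕ} (hg : good r = true) (hlt : r ^ k < 4294967296) :
    ∀ {c r0 : ℕ}, r0 ≤ r → r < r0 + c → (r ^ k, r) ∈ genK k c r0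
  | 0, r0, h1, h2 => by omega
  | c + 1, r0, h1, h2 => by
    rw [genK_succ]
    rcases h1.eq_or_lt with rfl | hlt'
    · have hb : Nat.blt (r0 ^ k) 4294967296 = true := by simp only [Nat.blt_eq]; exact hlt
      simp only [Nat.pow_eq, hg, hb, Bool.and_self, cond_true]
      exact List.mem_cons_self
    · have ih := mem_genK hg hlt (c := c) (r0 := r0 + 1) hlt' (by omega)
      cases (good r0 && Nat.blt (Nat.pow r0 k) 4294967296) <;> simp [ih]

/-- Unfolding `mergeV` on two nonempty lists. [folklore] -/
theorem mergeV_succ_cons_cons (f : ℕ) (a b : ℕ × ℕ) (as bs : List (ℕ × ℕ)) :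
    mergeV (f + 1) (a :: as) (b :: bs) =
      (bif Nat.ble a.1 b.1 then a :: mergeV f as (b :: bs) else b :: mergeV f (a :: as) bs) := rfl

/-- `mergeV` preserves membership (whatever the fuel). [folklore] -/
theorem mem_mergeV {x : ℕ × ℕ} :
    ∀ {f : ℕ} {l₁ l₂ : List (ℕ × ℕ)}, x ∈ mergeV f l₁ l₂ ↔ x ∈ l₁ ∨ x ∈ l₂
  | 0, l₁, l₂ => by simp [mergeV]
  | f + 1, [], l₂ => by simp [mergeV]
  | f + 1, a :: as, [] => by simp [mergeV]
  | f + 1, a :: as, b :: bs => by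
    rw [mergeV_succ_cons_cons]
    cases Nat.ble a.1 b.1
    · simp only [cond_false, List.mem_cons, mem_mergeV (f := f)]
      tauto
    · simp only [cond_true, List.mem_cons, mem_mergeV (f := f)]
      tauto

/-- Membership in `higher`. [folklore] -/
theorem mem_higher {k R r : ℕ} (hkR : (k, R) ∈ rangeTable) (hg : good r = true) (h2 : 2 ≤ r)
    (hR : r ≤ R) (hlt : r ^ k < 4294967296) : (r ^ k, r) ∈ higher := by
  unfold higher
  generalize rangeTable = L at hkR
  induction L with
  | nil => simp at hkR
  | cons kr L ih =>
    rw [List.foldr_cons, mem_mergeV]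
    rcases List.mem_cons.1 hkR with h | h
    · left
      rw [← h]
      exact mem_genK hg hlt h2 (by simp only; omega)
    · right
      exact ih h

/-- Unfolding `popLoop` on a nonempty list. [folklore] -/
theorem popLoop_succ_cons (f m2 r2 : ℕ) (e : ℕ × ℕ) (es : List (ℕ × ℕ))
    (cont : List (ℕ × ℕ) → List (ℕ × ℕ × ℕ)) :
    popLoop (f + 1) m2 r2 (e :: es) cont =
      (bif Nat.blt e.1 m2 then (e.1, e.2, r2) :: popLoop f m2 r2 es cont else cont (e :: es)) := rfl

/-- `popLoop` splits `rest` into a popped prefix and a remainder handed to `cont`. [folklore] -/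
theorem popLoop_eq (m2 r2 : ℕ) (cont : List (ℕ × ℕ) → List (ℕ × ℕ × ℕ)) :
    ∀ (f : ℕ) (rest : List (ℕ × ℕ)), ∃ l₁ l₂, rest = l₁ ++ l₂ ∧
      popLoop f m2 r2 rest cont = (l₁.map fun e => (e.1, e.2, r2)) ++ cont l₂
  | 0, rest => ⟨[], rest, rfl, rfl⟩
  | f + 1, [] => ⟨[], [], rfl, rfl⟩
  | f + 1, e :: es => by
    rw [popLoop_succ_cons]
    cases Nat.blt e.1 m2
    · exact ⟨[], e :: es, rfl, rfl⟩
    · obtain ⟨l₁, l₂, h1, h2⟩ := popLoop_eq m2 r2 cont f es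
      exact ⟨e :: l₁, l₂, by simp [h1], by simp [h2]⟩

/-- `evGen` with no fuel left emits the leftover events. [folklore] -/
theorem evGen_zero (m : ℕ) (rest : List (ℕ × ℕ)) :
    evGen 0 m rest = rest.map fun e => (e.1, e.2, Nat.pred m) := rfl

/-- Unfolding `evGen` one step. [folklore] -/
theorem evGen_succ (f m : ℕ) (rest : List (ℕ × ℕ)) :
    evGen (f + 1) m rest = popLoop 32 (m * m) (Nat.pred m) rest fun rest' =>
      bif good m then (m * m, m, m) :: evGen f (m + 1) rest' else evGen f (m + 1) rest' := rfl

/-- Square events of good bases are in the trace. [folklore] -/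
theorem mem_evGen_sq {m : ℕ} (hg : good m = true) :
    ∀ {f m0 : ℕ} {rest : List (ℕ × ℕ)}, m0 ≤ m → m < m0 + f → (m * m, m, m) ∈ evGen f m0 rest
  | 0, m0, rest, h1, h2 => by omega
  | f + 1, m0, rest, h1, h2 => by
    rw [evGen_succ]
    obtain ⟨l₁, l₂, -, hpop⟩ := popLoop_eq (m0 * m0) (Nat.pred m0)
      (fun rest' => bif good m0 then (m0 * m0, m0, m0) :: evGen f (m0 + 1) rest'
        else evGen f (m0 + 1) rest')
      32 rest
    rw [hpop, List.mem_append]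
    right
    rcases h1.eq_or_lt with rfl | hlt
    · simp [hg]
    · have ih := mem_evGen_sq hg (f := f) (m0 := m0 + 1) (rest := l₂) hlt (by omega)
      cases good m0 <;> simp [ih]

/-- Every element of `rest` appears in the trace (with some tag). [folklore] -/
theorem mem_evGen_rest {e : ℕ × ℕ} :
    ∀ {f m0 : ℕ} {rest : List (ℕ × ℕ)}, e ∈ rest → ∃ r2, (e.1, e.2, r2) ∈ evGen f m0 rest
  | 0, m0, rest, he => ⟨Nat.pred m0, by rw [evGen_zero]; exact List.mem_map.2 ⟨e, he, rfl⟩⟩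
  | f + 1, m0, rest, he => by
    rw [evGen_succ]
    obtain ⟨l₁, l₂, hsplit, hpop⟩ := popLoop_eq (m0 * m0) (Nat.pred m0)
      (fun rest' => bif good m0 then (m0 * m0, m0, m0) :: evGen f (m0 + 1) rest'
        else evGen f (m0 + 1) rest')
      32 rest
    rw [hpop]
    rw [hsplit, List.mem_append] at he
    rcases he with he | he
    · exact ⟨Nat.pred m0, List.mem_append.2 (Or.inl (List.mem_map.2 ⟨e, he, rfl⟩))⟩
    · obtain ⟨r2, hr2⟩ := mem_evGen_rest (f := f) (m0 := m0 + 1) (rest := l₂) he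
      refine ⟨r2, List.mem_append.2 (Or.inr ?_)⟩
      cases good m0 <;> simp [hr2]

/-- **Completeness, squares**: `(p², p, p)` is in the trace for every prime `p < 2^16`.
[cite: Nicolas2012, Lemma 2.4, proof, Case 1] -/
theorem mem_trace_sq {p : ℕ} (hp : p.Prime) (hple : p ≤ 65535) : (p * p, p, p) ∈ trace :=
  mem_evGen_sq (prime_good hp) hp.two_le (by omega)

/-- **Completeness, higher powers**: `(p^k, p, r2)` is in the trace for every prime power
`p^k < 2^32`, `3 ≤ k ≤ 31`. [cite: Nicolas2012, Lemma 2.4, proof, Case 1] -/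
theorem mem_trace_higher {p k : ℕ} (hp : p.Prime) (hk : 3 ≤ k) (hk' : k ≤ 31)
    (hlt : p ^ k < 4294967296) : ∃ r2, (p ^ k, p, r2) ∈ trace := by
  obtain ⟨kr, hkr, hkr1⟩ := rangeTable_complete k (by simp [hk, hk'])
  obtain ⟨k', R⟩ := kr
  simp only at hkr1
  subst hkr1
  have hR := rangeTable_sound _ hkr
  simp only at hR
  have hpR : p ≤ R := by
    by_contra hcon
    have h1 : (R + 1) ^ k' ≤ p ^ k' := Nat.pow_le_pow_left (by omega) _
    omega
  exact mem_evGen_rest (mem_higher hkr (prime_good hp) hp.two_le hpR hlt)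

/-! ### From the certificate to `ψ − θ` -/

/-- Past the `takeWhile (value ≤ n)` prefix of a strictly increasing trace all values exceed `n`.
[folklore] -/
theorem lt_of_mem_dropWhile {n : ℕ} :
    ∀ {l : List (ℕ × ℕ × ℕ)}, l.Pairwise (fun a b => a.1 < b.1) →
      ∀ {x}, x ∈ l.dropWhile (fun e => decide (e.1 ≤ n)) → n < x.1
  | [], _, x, hx => by simp at hx
  | a :: t, hl, x, hx => by
    rw [List.dropWhile_cons] at hx
    split_ifs at hx with ha
    · exact lt_of_mem_dropWhile (List.pairwise_cons.1 hl).2 hx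
    · have ha' : n < a.1 := by simpa using ha
      rcases List.mem_cons.1 hx with rfl | hx
      · exact ha'
      · exact ha'.trans ((List.pairwise_cons.1 hl).1 x hx)

/-- `θ(n^{1/k})` as a sum over the primes `p` with `p^k ≤ n`. [folklore] -/
theorem theta_rpow_eq (n k : ℕ) (hk : k ≠ 0) :
    θ ((n : ℝ) ^ ((1 : ℝ) / k)) =
      ∑ p ∈ (Finset.range (n + 1)).filter (fun p => p.Prime ∧ p ^ k ≤ n), Real.log p := by
  rw [Chebyshev.theta_eq_sum_Icc]
  have hy : (0 : ℝ) ≤ (n : ℝ) ^ ((1 : ℝ) / k) := by positivity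
  have hk0 : (0 : ℝ) < k := by exact_mod_cast Nat.pos_of_ne_zero hk
  have key : ∀ p : ℕ, p ≤ ⌊(n : ℝ) ^ ((1 : ℝ) / k)⌋₊ ↔ p ^ k ≤ n := by
    intro p
    rw [Nat.le_floor_iff hy, one_div,
      Real.le_rpow_inv_iff_of_pos (by positivity) (by positivity) hk0, Real.rpow_natCast]
    exact_mod_cast Iff.rfl
  refine Finset.sum_congr ?_ fun _ _ ↦ rfl
  ext p
  simp only [Finset.mem_filter, Finset.mem_Icc, Nat.zero_le, true_and, Finset.mem_range, key]
  constructor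
  · rintro ⟨h1, h2⟩
    exact ⟨Nat.lt_succ_of_le ((Nat.le_self_pow hk p).trans h1), h2, h1⟩
  · rintro ⟨-, h2, h1⟩
    exact ⟨h1, h2⟩

/-- **Main bound**: for `4 ≤ n < 2^32`,
`∑_{2 ≤ k ≤ 31} ∑_{p prime, p^k ≤ n} log p ≤ √n + 1.332769 n^{1/3}`.
[cite: Nicolas2012, Lemma 2.4, proof, Case 1] -/
theorem sum_log_le_of_case1Check {n : ℕ} (hn4 : 4 ≤ n) (hn : n < 4294967296) :
    ∑ k ∈ Finset.Icc 2 31, ∑ p ∈ (Finset.range (n + 1)).filter (fun p => p.Prime ∧ p ^ k ≤ n),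
      Real.log p ≤ rhs n := by
  have hct : checkTrace trace 0 1 1 = true := case1Check_eq_true
  obtain ⟨hA, hP, hB⟩ := checkTrace_sound Nat.one_pos hct
  -- the prefix of events with value `≤ n`
  set P : ℕ × ℕ × ℕ → Bool := fun e => decide (e.1 ≤ n) with hPdef
  set L := trace.takeWhile P with hLdef
  set D := trace.dropWhile P with hDdef
  have hsplit : trace = L ++ D := (List.takeWhile_append_dropWhile (p := P) (l := trace)).symm
  obtain ⟨t, ht⟩ := trace_eq_cons
  have hLne : L ≠ [] := by
    rw [hLdef, ht, List.takeWhile_cons]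
    simp [hPdef, hn4]
  set e := L.getLast hLne with hedef
  have heL : e ∈ L := List.getLast_mem hLne
  have hev : e.1 ≤ n := by simpa [hPdef] using List.mem_takeWhile_imp heL
  have hLe : L.dropLast ++ [e] = L := List.dropLast_append_getLast hLne
  -- the certified inequality at `e`
  have htr : trace = L.dropLast ++ e :: D := by
    rw [hsplit]
    nth_rw 1 [← hLe]
    simp
  have hbound : Real.log (bprod L : ℝ) ≤ rhs e.1 := by
    have := hB L.dropLast e D htr
    rwa [hLe, one_mul] at this
  have hrhs : rhs e.1 ≤ rhs n := rhs_le (by exact_mod_cast hev)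
  -- structure of `L`
  have hPL : L.Pairwise (fun a b => a.1 < b.1) := hP.sublist (List.takeWhile_sublist _)
  have hnodup : L.Nodup := hPL.imp fun {a b} h heq ↦ by subst heq; exact lt_irrefl _ h
  have hAL : ∀ x ∈ L, 2 ≤ x.2.1 := fun x hx ↦ (hA x ((List.takeWhile_sublist _).subset hx)).2
  -- `log (bprod L) = ∑ log bases`
  have hlogL : Real.log (bprod L : ℝ) = ∑ x ∈ L.toFinset, Real.log (x.2.1 : ℝ) := by
    have h1 : bprod L = ∏ x ∈ L.toFinset, x.2.1 := by
      unfold bprod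
      exact (List.prod_toFinset (fun x : ℕ × ℕ × ℕ => x.2.1) hnodup).symm
    rw [h1, Nat.cast_prod, Real.log_prod]
    intro x hx
    have := hAL x (List.mem_toFinset.1 hx)
    positivity
  -- reindex the left-hand side by events `(p^k, p)`
  set E := ((Finset.Icc 2 31) ×ˢ Finset.range (n + 1)).filter
    (fun kp => kp.2.Prime ∧ kp.2 ^ kp.1 ≤ n) with hEdef
  have hE : ∑ k ∈ Finset.Icc 2 31,
      ∑ p ∈ (Finset.range (n + 1)).filter (fun p => p.Prime ∧ p ^ k ≤ n), Real.log (p : ℝ) =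
        ∑ kp ∈ E, Real.log (kp.2 : ℝ) := by
    rw [hEdef, Finset.sum_filter, Finset.sum_product]
    refine Finset.sum_congr rfl fun k _ ↦ ?_
    rw [Finset.sum_filter]
  set φ : ℕ × ℕ → ℕ × ℕ := fun kp => (kp.2 ^ kp.1, kp.2) with hφ
  set g : ℕ × ℕ × ℕ → ℕ × ℕ := fun x => (x.1, x.2.1) with hg
  have hφinj : ∀ x ∈ E, ∀ y ∈ E, φ x = φ y → x = y := by
    intro x hx y hy hxy
    simp only [hφ, Prod.mk.injEq] at hxy
    simp only [hEdef, Finset.mem_filter] at hx hy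
    have hp : 2 ≤ x.2 := hx.2.1.two_le
    have h3 : x.2 ^ x.1 = x.2 ^ y.1 := by
      conv_rhs => rw [hxy.2]
      exact hxy.1
    have h2 : x.1 = y.1 := Nat.pow_right_injective hp h3
    exact Prod.ext h2 hxy.2
  have hginj : ∀ x ∈ L.toFinset, ∀ y ∈ L.toFinset, g x = g y → x = y := by
    intro x hx y hy hxy
    simp only [hg, Prod.mk.injEq] at hxy
    rw [List.mem_toFinset] at hx hy
    obtain ⟨i, hi, rfl⟩ := List.getElem_of_mem hx
    obtain ⟨j, hj, rfl⟩ := List.getElem_of_mem hy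
    rcases lt_trichotomy i j with hij | rfl | hij
    · exact absurd hxy.1 (ne_of_lt (List.pairwise_iff_getElem.1 hPL i j hi hj hij))
    · rfl
    · exact absurd hxy.1.symm (ne_of_lt (List.pairwise_iff_getElem.1 hPL j i hj hi hij))
  have hsub : E.image φ ⊆ L.toFinset.image g := by
    intro y hy
    rw [Finset.mem_image] at hy ⊢
    obtain ⟨⟨k, p⟩, hkp, rfl⟩ := hy
    simp only [hEdef, Finset.mem_filter, Finset.mem_product, Finset.mem_Icc, Finset.mem_range]
      at hkp
    obtain ⟨⟨⟨hk2, hk31⟩, -⟩, hp, hpk⟩ := hkp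
    have hpk' : p ^ k < 4294967296 := lt_of_le_of_lt hpk hn
    -- the event `(p^k, p, r2)` is in the trace …
    obtain ⟨r2, hr2⟩ : ∃ r2, (p ^ k, p, r2) ∈ trace := by
      rcases (show k = 2 ∨ 3 ≤ k by omega) with rfl | hk3
      · refine ⟨p, ?_⟩
        have hp2 : p ≤ 65535 := by
          by_contra hcon
          have : 65536 ^ 2 ≤ p ^ 2 := Nat.pow_le_pow_left (by omega) 2
          omega
        simpa [sq] using mem_trace_sq hp hp2
      · exact mem_trace_higher hp hk3 hk31 hpk'
    -- … and, having value `≤ n`, in the prefix `L`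
    have hrL : (p ^ k, p, r2) ∈ L := by
      rw [hsplit, List.mem_append] at hr2
      rcases hr2 with h | h
      · exact h
      · exact absurd hpk (not_le.2 (lt_of_mem_dropWhile hP h))
    exact ⟨(p ^ k, p, r2), List.mem_toFinset.2 hrL, rfl⟩
  -- assemble
  calc ∑ k ∈ Finset.Icc 2 31, ∑ p ∈ (Finset.range (n + 1)).filter (fun p => p.Prime ∧ p ^ k ≤ n),
        Real.log (p : ℝ)
      = ∑ kp ∈ E, Real.log (kp.2 : ℝ) := hE
    _ = ∑ y ∈ E.image φ, Real.log (y.2 : ℝ) := by rw [Finset.sum_image hφinj]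
    _ ≤ ∑ y ∈ L.toFinset.image g, Real.log (y.2 : ℝ) :=
        Finset.sum_le_sum_of_subset_of_nonneg hsub fun y _ _ ↦ Real.log_natCast_nonneg _
    _ = ∑ x ∈ L.toFinset, Real.log (x.2.1 : ℝ) := by rw [Finset.sum_image hginj]
    _ = Real.log (bprod L : ℝ) := hlogL.symm
    _ ≤ rhs n := hbound.trans hrhs

/-- **Case 1 at natural numbers**: `ψ(n) − θ(n) ≤ √n + 1.332769 n^{1/3}` for `1 ≤ n < 2^32`.
[cite: Nicolas2012, Lemma 2.4, proof, Case 1] -/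
theorem psi_sub_theta_natCast_le {n : ℕ} (hn1 : 1 ≤ n) (hn : n < 4294967296) :
    ψ (n : ℝ) - θ (n : ℝ) ≤ rhs n := by
  have hrhs0 : 0 ≤ rhs n := by unfold rhs; positivity
  rcases (show n = 1 ∨ 2 ≤ n by omega) with rfl | hn2
  · rw [Nat.cast_one, Chebyshev.psi_eq_zero_of_lt_two one_lt_two,
      Chebyshev.theta_eq_zero_of_lt_two one_lt_two, sub_zero]
    exact hrhs0
  have hx2 : (2 : ℝ) ≤ n := by exact_mod_cast hn2
  have hN : ⌊Real.log n / Real.log 2⌋₊ ≤ 31 := by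
    have hlog2 : 0 < Real.log 2 := Real.log_pos one_lt_two
    have hlt : Real.log n / Real.log 2 < 32 := by
      rw [div_lt_iff₀ hlog2]
      have h32 : Real.log ((2 : ℝ) ^ 32) = 32 * Real.log 2 := by
        rw [Real.log_pow]; norm_num
      rw [← h32]
      refine Real.log_lt_log (by positivity) ?_
      have : ((n : ℕ) : ℝ) < ((4294967296 : ℕ) : ℝ) := by exact_mod_cast hn
      convert this using 1
      norm_num
    by_contra hcon
    push Not at hcon
    have h1 : (32 : ℝ) ≤ ⌊Real.log n / Real.log 2⌋₊ := by exact_mod_cast hcon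
    have h2 : (⌊Real.log n / Real.log 2⌋₊ : ℝ) ≤ Real.log n / Real.log 2 :=
      Nat.floor_le (div_nonneg (Real.log_natCast_nonneg n) hlog2.le)
    linarith
  rw [Chebyshev.psi_eq_theta_add_sum_theta' hx2 hN, add_sub_cancel_left]
  have hsum : ∑ k ∈ Finset.Icc (2 : ℕ) 31, θ ((n : ℝ) ^ ((1 : ℝ) / k)) =
      ∑ k ∈ Finset.Icc (2 : ℕ) 31,
        ∑ p ∈ (Finset.range (n + 1)).filter (fun p => p.Prime ∧ p ^ k ≤ n), Real.log (p : ℝ) :=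
    Finset.sum_congr rfl fun k hk ↦ theta_rpow_eq n k (by have := (Finset.mem_Icc.1 hk).1; omega)
  rw [hsum]
  rcases lt_or_ge n 4 with hn4 | hn4
  · -- below `4` there are no prime powers: every inner sum is empty
    have hempty : ∀ k ∈ Finset.Icc 2 31,
        (Finset.range (n + 1)).filter (fun p => p.Prime ∧ p ^ k ≤ n) = ∅ := by
      intro k hk
      rw [Finset.filter_eq_empty_iff]
      rintro p - ⟨hp, hpk⟩
      have hk2 : 2 ≤ k := (Finset.mem_Icc.1 hk).1
      have h1 : 2 ^ k ≤ p ^ k := Nat.pow_le_pow_left hp.two_le k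
      have h2 : 2 ^ 2 ≤ 2 ^ k := Nat.pow_le_pow_right (by norm_num) hk2
      omega
    rw [Finset.sum_eq_zero fun k hk ↦ by rw [hempty k hk, Finset.sum_empty]]
    exact hrhs0
  · exact sum_log_le_of_case1Check hn4 hn

end Nicolas2012Case1

/-- **Nicolas 2012, Lemma 2.4, proof, Case 1** (discharge of the named fact
`Nicolas2012_lemma24_case1`): for real `1 ≤ x < 2^32`, `ψ(x) − θ(x) ≤ √x + 1.332769 · x^{1/3}` —
by the kernel-checked certificate `Nicolas2012Case1.case1Check_eq_true` and its soundness
`Nicolas2012Case1.sum_log_le_of_case1Check`. [cite: Nicolas2012, Lemma 2.4, proof, Case 1] -/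
theorem Nicolas2012_lemma24_case1_holds : Nicolas2012_lemma24_case1 := by
  intro x hx1 hx32
  have hx0 : 0 ≤ x := by linarith
  have hn1 : 1 ≤ ⌊x⌋₊ := Nat.le_floor (by simpa using hx1)
  have hnx : (⌊x⌋₊ : ℝ) ≤ x := Nat.floor_le hx0
  have hn32 : ⌊x⌋₊ < 4294967296 := by
    have : (⌊x⌋₊ : ℝ) < 4294967296 := hnx.trans_lt (by norm_num at hx32; exact hx32)
    exact_mod_cast this
  rw [Chebyshev.psi_eq_psi_coe_floor, Chebyshev.theta_eq_theta_coe_floor]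
  exact (Nicolas2012Case1.psi_sub_theta_natCast_le hn1 hn32).trans (Nicolas2012Case1.rhs_le hnx)

end Literature.NumberTheory.LFunctions
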